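/-
Copyright (c) 2026 the pub-hodgecm-mathlib formalisation cell (harness21).  Prover seat hodgecm-mathlib-LH4-p19 (g3), req620 Track A «(D-RAM) FOUR-FRAME» squad
(STAGE-1b, row (2) of the piece `f_{T₊}`, the (β₂) road (R-36) «PURE-CELL LEDGER»; β₂ WORD #29∕#31 «p19: RAY BANDS» — the cell-level letters of an upper-line RAY ∩ LOW cell,
produced from the opened ‹OFF.letter.v2› block), 2026-09-05.
-/
import Summits.HodgeConjecture.HodgeConjecture.Theorems.F0P3cDyRamUpperLineCellCentre              -- ★ p864286 (this seat, F3): centre ∕ slope identities, Eisenstein approximation; brings ★ DEFS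
import Literature.NumberTheory.LocalFields.WildQuadraticDatumNormSignConductor                     -- ★ Lit: brings `v_eq_one_of_v_mul_map_eq_one`, `IsRamifiedQuadraticDatum`
import HarnessLib

/-!
# Crux `H413`, line LH4 «(D-RAM) FOUR-FRAME» — STAGE-1b, row (2), the (β₂) road (R-36), (OFF) residue, RAY bands: «THE CELL LETTERS OF AN UPPER-LINE RAY ∩ LOW CELL» — parity
# `j − b = 2n`, and, given the reference pair at `|ξ₀| = e^{2n}`, the centre `W`, the slope `B`, and `σ`-fixed `γ₁, W₁` with the SLOPE letter `|B∕(P·t₊) − γ₁| ≤ |γ₁|·|ϖ|^{2d−1}`,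
# the ROOT letter `|γ₁(W − W₁)| ≤ |ϖ|^{2d−1}`, and the digit sizes `|γ₁|·|ϖ|^b = |ϖ|^{s−ℓ₀} ≤ |ϖ|^{2d−1}`, `|ϖ|^{2d−2} ≤ |γ₁|·|ϖ|^{2d−1}`, `1 ≤ |γ₁|`, `|W₁| ≤ 1`

Cell `hodgecm-mathlib` (D-0151), FLOOR 0, crux item H413 = `stmt-HodgeConjecture-24833`, route of record `HCCMUnconditional`; squad F0∕P3c∕LH4; lane
`--supports stmt-HodgeConjecture-24833 --as helper` (count-neutral; pays NO tier-0 row).  THEOREMS ONLY (no `def`, no instance, no notation, no `sorry`, default heartbeats);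
★-only imports; states NO law; (β₂) stays a HYPOTHESIS.  Frame = opened ‹OFF.letter.v2› letters: the E-datum, the `jE`-letters, `ρ`, `Θ`, the line model's `lam` with
`Θlam·lam = 1`, `|lam| = 1`, `lam² = tr·lam − det`, `ρlam = tr − lam`, `det·σdet = 1`, the deep token `|lam − 1| ≤ |ϖE|^{3d−2}` (⟸ `_hlam1` at the floor `N ≥ m_c`), the `u`-entry
(`uσu = 1`, `|u| = 1`), the sizes `|μ| = e^{−m}`, `|μ − ρμ| = e^{−jl}` (`μ = lam − jE u`), and the cell: `j = b + 2n`, `j + m = jl + b` (upper line), `m < 2b`, RAY `m⋆ + b ≤ m`,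
LOW `m_c + 2b ≤ 2m` (`m⋆ = d%2 + 2d − 1`, `m_c = 3d − 2 + d%2`, spelled out).

WHY (β₂ WORD #29 «p19: RAY BANDS»; consumers ★ p864374 R1a, ★ p864444 R1b-A, ★ p864531 R1b-B and this seat's R1 worker).  The vertex reads of an upper-line RAY cell are
stated against CELL-LEVEL constants: the reference pair `κ₀, ξ₀` (★ F4 §3, at `|ξ₀| = e^{j−b}`), the centre coordinate `W` (`jE W·ξ₀ = κ_c − κ₀`, `κ_c = ρμ∕(ρμ − μ)`), the slope
`B` (`jE B = (μ − ρμ)ξ₀`), `P = (ϖσϖ)^b`, and `σ`-fixed Eisenstein approximations `γ₁` of `θ = B∕(P·t₊)` and `W₁` of `W`.  This file produces them with their letters: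
* §1 `exists_eq_add_two_mul_of_level` — PARITY: a member of `levelSet(j, b)` has `h·N_Θ(x₀) ∈ Fix Θ` of size `e^{j−b}` (`|Y| = |ϖE|^b`, `|cc(α − ρα)| = e^{−j}`), and Θ-fixed
  elements of the ramified M-datum have even valuation ⟹ `j = b + 2n`.
* §2 HEAD `exists_cellLetters` — `∃ W B γ₁ W₁` with: the centre and slope identities; `σγ₁ = γ₁`, `σW₁ = W₁`; SLOPE `|B∕(P·t₊) − γ₁| ≤ |γ₁|·|ϖ|^{2d−1}` (`σB = −B∕det`,
  `σt₊ = −t₊` ⟹ `σθ = θ∕det`, `|det − 1| ≤ |ϖ|^{3d−2}` ⟹ `|θ − σθ| ≤ |θ|·|ϖ|^{3d−2}` ⟹ ★ F3 §0 Eisenstein `|θ − γ₁| ≤ |θ|·|ϖ|^{2d−1} < |θ|`); ROOT `|γ₁(W − W₁)| ≤ |ϖ|^{2d−1}`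
  (`|W − σW| = |κ_c|·|μ|∕|ξ₀| = e^{−m}` by ★ F3, Eisenstein `|W − W₁| = e^{−m+d−1}`, `|γ₁| = |θ| = e^{2b+ℓ₀−m}`, and LOW `2(m − b) ≥ m_c`); the digit sizes
  `|γ₁|·|ϖ|^b = |ϖ|^{m−b−ℓ₀}`, `1 ≤ |γ₁|`, `|γ₁|·|ϖ|^b ≤ |ϖ|^{2d−1}` (RAY), `|ϖ|^{2d−2} ≤ |γ₁|·|ϖ|^{2d−1}` (`m < 2b`), `|W₁| ≤ 1`.
HONEST LABEL.  Count-neutral algebra; nothing printed is asserted; no census law is stated; `hU_ray`, `hD_ray`, `hL_ray` stay OPEN; `HC_CM` is proved only modulo the 7 printed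
citations (2 remaining named inputs: hLiu418 = `stmt-HodgeConjecture-24832`, h413 = `stmt-HodgeConjecture-24833`) until rung 0 closes.
## References
* [Kottwitz1986BaseChangeUnits] R. E. Kottwitz, *Base change for unit elements of Hecke algebras*, Compositio Math. 60 (1986): §3 (the cell constants of a cone cell).
* [Serre1979] J.-P. Serre, *Local Fields*, GTM 67 (1979): Ch. III §6 Prop. 12 (Eisenstein coordinates), Ch. V §3 (even valuation of norms ∕ fixed elements), Ch. XV §2.
* [Rogawski1990] J. D. Rogawski, *Automorphic Representations of Unitary Groups in Three Variables*, Ann. of Math. Stud. 123 (1990): §4.9 Prop. 4.9.1 (b) p. 55, §12.2.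
-/

set_option autoImplicit false

noncomputable section

namespace Summit.HodgeConjecture.HodgeConjecture.Cruxes.H413.F0P3cDyRamUpperRayCellLetters

open scoped Valued WithZero
open WithZero
open Literature.NumberTheory.Automorphic.UnitaryThreeFourFrame (IsRamifiedQuadraticDatum)
open Literature.NumberTheory.LocalFields.WildQuadraticDatum (v_eq_one_of_v_mul_map_eq_one)
open Literature.NumberTheory.Rogawski1990
open Summit.HodgeConjecture.HodgeConjecture.Cruxes.H413.F0P3cDyRamToricCensusDefs
open Summit.HodgeConjecture.HodgeConjecture.Cruxes.H413.F0P3cDyRamUpperLineCellCentre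

variable {E M : Type} [Field E] [Valued E ℤᵐ⁰] [Field M] [Valued M ℤᵐ⁰] {ρ Θ : M →+* M} {α : M}

/-! ## §1 Parity of an upper-line cell -/

/-- **PARITY — «`j − b` IS EVEN ON A POPULATED CELL»**: at the ramified M-datum (`Θ`-fixed non-zero elements have even valuation), `|cc(α − ρα)| = |ϖE|^j` (`|α − ρα| = 1`),
`Θh = h`; a generator `x₀` of a member of `levelSet(j, b)` (`|Y| = |ϖE|^b`, `Y = h·N_Θ(x₀)·cc(α − ρα)`) with `b ≤ j` ⟹ `j = b + 2n`.
[cite: Serre1979, Ch. V §3] [cite: Kottwitz1986BaseChangeUnits, §3] -/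
theorem exists_eq_add_two_mul_of_level {ϖM : M} {d tE : ℕ} (hDM : IsRamifiedQuadraticDatum Θ ϖM d tE) (hΘΘ : ∀ x, Θ (Θ x) = x)
    {hM : M} (hΘh : Θ hM = hM) (hU : Valued.v (α - ρ α) = 1) {j b : ℕ} (hbj : b ≤ j) {x₀ : M}
    (hylev : Valued.v (dualGen ρ Θ α (ϖM ^ j) hM x₀) = Valued.v ϖM ^ b) : ∃ n : ℕ, j = b + 2 * n := by
  obtain ⟨-, -, hϖM, hfix, -, -, -⟩ := id hDM
  have hPn : ∀ k : ℕ, Valued.v ϖM ^ k = exp (-(k : ℤ)) := fun k => by rw [hϖM, ← exp_nsmul]; congr 1; simp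
  set u₀ : M := hM * (x₀ * Θ x₀) with hu₀def
  have hΘu : Θ u₀ = u₀ := by rw [hu₀def, map_mul, map_mul, hΘh, hΘΘ]; ring
  have hY : dualGen ρ Θ α (ϖM ^ j) hM x₀ = u₀ * (ϖM ^ j * (α - ρ α)) := by rw [dualGen_def]
  have hu0 : u₀ ≠ 0 := fun h0 => by
    rw [hY, h0, zero_mul, map_zero] at hylev
    exact pow_ne_zero _ (by rw [hϖM]; exact exp_ne_zero) hylev.symm
  obtain ⟨k, hk⟩ := hfix u₀ hΘu hu0
  rw [hY, Valuation.map_mul, hk, Valuation.map_mul, Valuation.map_pow, hU, mul_one, hPn, hPn, ← exp_add, exp_inj] at hylev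
  exact ⟨k.toNat, by omega⟩

/-! ## §2 HEAD — the cell letters -/

/-- **HEAD — «THE CELL LETTERS OF AN UPPER-LINE RAY ∩ LOW CELL».**  See the module docstring for the frame and the list; `t₊ = (ϖ − σϖ)·((ϖσϖ)^{(d−d%2)∕2})⁻¹`, `P = (ϖσϖ)^b`,
`μ = lam − jE u`.  Outputs `W B γ₁ W₁ : E` with: `jE W·ξ₀ = ρμ∕(ρμ − μ) − κ₀`; `jE B = (μ − ρμ)·ξ₀`; `σγ₁ = γ₁`; `σW₁ = W₁`; `|B∕(P·t₊) − γ₁| ≤ |γ₁|·|ϖ|^{2d−1}`;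
`|γ₁(W − W₁)| ≤ |ϖ|^{2d−1}`; `|γ₁|·|ϖ|^b = |ϖ|^{m−b−d%2}`; `1 ≤ |γ₁|`; `|γ₁|·|ϖ|^b ≤ |ϖ|^{2d−1}`; `|ϖ|^{2d−2} ≤ |γ₁|·|ϖ|^{2d−1}`; `|W₁| ≤ 1`.
[cite: Kottwitz1986BaseChangeUnits, §3] [cite: Serre1979, Ch. III §6 Prop. 12; Ch. XV §2] [cite: Rogawski1990, §4.9 Prop. 4.9.1 (b) p. 55] -/
theorem exists_cellLetters {σ : E →+* E} {ϖ : E} {d tE : ℕ} (hD : IsRamifiedQuadraticDatum σ ϖ d tE)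
    (jE : E →+* M) (hjiso : ∀ a, Valued.v (jE a) = Valued.v a) (hjfix : ∀ z, ρ z = z ↔ ∃ c, jE c = z) (hΘj : ∀ c, Θ (jE c) = jE (σ c))
    (hρρ : ∀ x, ρ (ρ x) = x) (hvρ : ∀ x, Valued.v (ρ x) = Valued.v x) (hΘρ : ∀ x, Θ (ρ x) = ρ (Θ x))
    {lam : M} (hΘlam : Θ lam * lam = 1) (hvlam : Valued.v lam = 1)
    {tr det : E} (hdet : det * σ det = 1) (hlam2 : lam * lam = jE tr * lam - jE det) (hρlam : ρ lam = jE tr - lam)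
    (hlam3 : Valued.v (lam - 1) ≤ Valued.v (jE ϖ) ^ (3 * d - 2))
    {u : E} (huu : u * σ u = 1) (hu : Valued.v u = 1)
    {m jl : ℕ} (hm : Valued.v (lam - jE u) = exp (-(m : ℤ))) (hjl : Valued.v ((lam - jE u) - ρ (lam - jE u)) = exp (-(jl : ℤ)))
    {j b n : ℕ} (hjbn : j = b + 2 * n) (hline : j + m = jl + b) (h2bm : m < 2 * b) (hray : d % 2 + 2 * d - 1 + b ≤ m)
    (hlow : 3 * d - 2 + d % 2 + 2 * b ≤ 2 * m)
    {κ₀ ξ₀ : M} (hκ₀ : κ₀ + ρ κ₀ = 1) (hΘκ₀ : Θ κ₀ = κ₀) (hξ : ρ ξ₀ = -ξ₀) (hΘξ : Θ ξ₀ = ξ₀) (hξ0 : ξ₀ ≠ 0)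
    (hκ₀1 : Valued.v κ₀ ≤ 1) (hξv : Valued.v ξ₀ = exp (2 * (n : ℤ))) :
    ∃ W BE γ₁ W₁ : E,
      jE W * ξ₀ = ρ (lam - jE u) / (ρ (lam - jE u) - (lam - jE u)) - κ₀ ∧
      jE BE = ((lam - jE u) - ρ (lam - jE u)) * ξ₀ ∧ σ γ₁ = γ₁ ∧ σ W₁ = W₁ ∧
      Valued.v (BE / ((ϖ * σ ϖ) ^ b * ((ϖ - σ ϖ) * ((ϖ * σ ϖ) ^ ((d - d % 2) / 2))⁻¹)) - γ₁) ≤ Valued.v γ₁ * Valued.v ϖ ^ (2 * d - 1) ∧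
      Valued.v (γ₁ * (W - W₁)) ≤ Valued.v ϖ ^ (2 * d - 1) ∧
      Valued.v γ₁ * Valued.v ϖ ^ b = Valued.v ϖ ^ (m - b - d % 2) ∧ 1 ≤ Valued.v γ₁ ∧
      Valued.v γ₁ * Valued.v ϖ ^ b ≤ Valued.v ϖ ^ (2 * d - 1) ∧ Valued.v ϖ ^ (2 * d - 2) ≤ Valued.v γ₁ * Valued.v ϖ ^ (2 * d - 1) ∧
      Valued.v W₁ ≤ 1 := by
  obtain ⟨hσσ, hvσ, hϖ, -, hd, hd1, -⟩ := id hD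
  have hvϖ0 : Valued.v ϖ ≠ 0 := by rw [hϖ]; exact exp_ne_zero
  have hϖ0 : ϖ ≠ 0 := fun h0 => hvϖ0 (by rw [h0, map_zero])
  have hϖpos : (0 : ℤᵐ⁰) < Valued.v ϖ := zero_lt_iff.2 hvϖ0
  have hϖlt : Valued.v ϖ < 1 := by rw [hϖ, ← exp_zero, exp_lt_exp]; norm_num
  have hσϖ0 : σ ϖ ≠ 0 := (map_ne_zero σ).2 hϖ0
  have hPnE : ∀ k : ℕ, Valued.v ϖ ^ k = exp (-(k : ℤ)) := fun k => by rw [hϖ, ← exp_nsmul]; congr 1; simp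
  have hρj : ∀ c : E, ρ (jE c) = jE c := fun c => (hjfix _).2 ⟨c, rfl⟩
  have hϖσ : σ ϖ ≠ ϖ := fun h => by rw [h, sub_self, map_zero] at hd; exact pow_ne_zero _ hvϖ0 hd.symm
  have hjl2 : (jl : ℤ) = 2 * n + m := by push_cast [hjbn] at hline ⊢; omega
  have hμρ : ρ (lam - jE u) ≠ lam - jE u := fun h => by
    rw [h, sub_self, map_zero] at hjl; exact exp_ne_zero hjl.symm
  have hξpos : (0 : ℤᵐ⁰) < Valued.v ξ₀ := zero_lt_iff.2 ((Valuation.ne_zero_iff _).2 hξ0)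
  -- the centre coordinate and the slope
  obtain ⟨W, hWc⟩ := exists_centre_coord jE hjfix hρρ hμρ hκ₀ hξ hξ0
  have hρB : ρ (((lam - jE u) - ρ (lam - jE u)) * ξ₀) = ((lam - jE u) - ρ (lam - jE u)) * ξ₀ := by
    rw [map_mul, map_sub, hρρ, hξ]; ring
  obtain ⟨BE, hBE⟩ := (hjfix _).1 hρB
  -- determinant letters
  have hdetv : Valued.v det = 1 := v_eq_one_of_v_mul_map_eq_one hvσ (by rw [hdet]; exact map_one _)
  have hdet0 : det ≠ 0 := fun h0 => by rw [h0, map_zero] at hdetv; exact zero_ne_one hdetv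
  have hll : lam * ρ lam = jE det := by
    have e : lam * ρ lam = jE tr * lam - lam * lam := by rw [hρlam]; ring
    rw [e, hlam2]; ring
  have hdet1 : Valued.v (det - 1) ≤ Valued.v ϖ ^ (3 * d - 2) := by
    rw [← hjiso, map_sub, map_one, ← hll, ← hjiso ϖ]
    have e : lam * ρ lam - 1 = (lam - 1) * ρ lam + ρ (lam - 1) := by rw [map_sub, map_one]; ring
    rw [e]
    refine (Valuation.map_add _ _ _).trans (max_le ?_ ?_)
    · rw [Valuation.map_mul, hvρ, hvlam, mul_one]; exact hlam3
    · rw [hvρ]; exact hlam3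
  -- `σ` of the slope: `σB = −B ∕ det`
  have hl0 : lam ≠ 0 := fun h0 => by rw [h0, map_zero] at hvlam; exact zero_ne_one hvlam
  have hρl0 : ρ lam ≠ 0 := fun h0 => hl0 (by rw [← hρρ lam, h0, map_zero])
  have hσBE : σ BE = -BE / det := jE.injective (by
    rw [← hΘj, map_div₀, map_neg, hBE, map_mul, hΘξ, ← hll, map_skew_eq_neg_div σ jE hΘj hρj hΘρ hΘlam huu]
    field_simp)
  set P : E := (ϖ * σ ϖ) ^ b with hPdef
  set tp : E := (ϖ - σ ϖ) * ((ϖ * σ ϖ) ^ ((d - d % 2) / 2))⁻¹ with htpdef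
  have hσP : σ P = P := by rw [hPdef, map_pow, map_mul, hσσ, mul_comm (σ ϖ) ϖ]
  have hσtp : σ tp = -tp := by
    rw [htpdef, map_mul, map_inv₀, map_pow, map_mul, map_sub, hσσ, mul_comm (σ ϖ) ϖ]; ring
  have hP0 : P ≠ 0 := pow_ne_zero _ (mul_ne_zero hϖ0 hσϖ0)
  have hPv : Valued.v P = Valued.v ϖ ^ (2 * b) := by rw [hPdef, Valuation.map_pow, Valuation.map_mul, hvσ, ← pow_two, ← pow_mul]
  have htpv : Valued.v tp = Valued.v ϖ ^ (d % 2) := by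
    have h1 : Valued.v tp * Valued.v ϖ ^ (2 * ((d - d % 2) / 2)) = Valued.v ϖ ^ d := by
      rw [htpdef, Valuation.map_mul, Valuation.map_inv, Valuation.map_pow, Valuation.map_mul, hvσ, ← pow_two, ← pow_mul, hd,
        inv_mul_cancel_right₀ (pow_ne_zero _ hvϖ0)]
    have h2 : Valued.v ϖ ^ d = Valued.v ϖ ^ (d % 2) * Valued.v ϖ ^ (2 * ((d - d % 2) / 2)) := by rw [← pow_add]; congr 1; omega
    exact mul_right_cancel₀ (pow_ne_zero _ hvϖ0) (h1.trans h2)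
  have htp0 : tp ≠ 0 := fun h0 => by rw [h0, map_zero] at htpv; exact pow_ne_zero _ hvϖ0 htpv.symm
  -- the slope ratio `θ` and its `σ`
  set θ : E := BE / (P * tp) with hθdef
  have hBE0 : BE ≠ 0 := fun h0 => by
    have : ((lam - jE u) - ρ (lam - jE u)) * ξ₀ = 0 := by rw [← hBE, h0, map_zero]
    exact mul_ne_zero (sub_ne_zero.2 (Ne.symm hμρ)) hξ0 this
  have hθ0 : θ ≠ 0 := div_ne_zero hBE0 (mul_ne_zero hP0 htp0)
  have hθpos : (0 : ℤᵐ⁰) < Valued.v θ := zero_lt_iff.2 ((Valuation.ne_zero_iff _).2 hθ0)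
  have hσθ : σ θ = θ / det := by
    rw [hθdef, map_div₀, map_mul, hσBE, hσP, hσtp]; field_simp
  have hθσv : Valued.v (θ - σ θ) ≤ Valued.v θ * Valued.v ϖ ^ (3 * d - 2) := by
    have e : θ - σ θ = θ * ((det - 1) / det) := by rw [hσθ]; field_simp
    rw [e, Valuation.map_mul, map_div₀ _ (det - 1) det, hdetv, div_one]; exact mul_le_mul' le_rfl hdet1
  -- Eisenstein approximation of the slope ratio
  obtain ⟨γ₁, hσγ, hγ⟩ := exists_fixed_v_sub_mul_eq hσσ hϖσ θ
  have hθγ : Valued.v (θ - γ₁) ≤ Valued.v θ * Valued.v ϖ ^ (2 * d - 1) := by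
    have h1 : Valued.v (θ - γ₁) * Valued.v ϖ ^ d ≤ Valued.v θ * Valued.v ϖ ^ (2 * d - 1) * Valued.v ϖ ^ d := by
      rw [← hd, hγ]
      calc Valued.v (θ - σ θ) * Valued.v ϖ ≤ Valued.v θ * Valued.v ϖ ^ (3 * d - 2) * Valued.v ϖ := mul_le_mul' hθσv le_rfl
        _ = Valued.v θ * Valued.v ϖ ^ (2 * d - 1) * Valued.v (ϖ - σ ϖ) := by
          rw [hd, mul_assoc, mul_assoc, ← pow_succ, ← pow_add]; congr 2; omega
    have h2 := (div_le_iff₀ (pow_pos hϖpos d)).2 h1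
    rwa [mul_div_assoc, div_self (pow_ne_zero _ hvϖ0), mul_one] at h2
  have h2d1 : Valued.v ϖ ^ (2 * d - 1) < 1 := pow_lt_one₀ zero_le hϖlt (by omega)
  have hθlt : Valued.v (θ - γ₁) < Valued.v θ :=
    hθγ.trans_lt (by
      calc Valued.v θ * Valued.v ϖ ^ (2 * d - 1) < Valued.v θ * 1 := mul_lt_mul_of_pos_left h2d1 hθpos
        _ = Valued.v θ := mul_one _)
  have hγv : Valued.v γ₁ = Valued.v θ := by
    have e : γ₁ = θ - (θ - γ₁) := by ring
    rw [e, Valuation.map_sub_eq_of_lt_left _ hθlt]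
  -- the size of `θ`: `|θ| = e^{2b + ℓ₀ − m}`
  have hBEv : Valued.v BE = exp (-(jl : ℤ)) * exp (2 * (n : ℤ)) := by rw [← hjiso, hBE, Valuation.map_mul, hjl, hξv]
  have hθv : Valued.v θ = exp (2 * (b : ℤ) + (d % 2 : ℕ) - m) := by
    rw [hθdef, Valuation.map_div, Valuation.map_mul, hBEv, hPv, htpv, hPnE, hPnE, ← exp_add, ← exp_add, ← exp_sub]
    congr 1; push_cast; omega
  -- the root: `|W − σW| = e^{−m}`, Eisenstein `W₁`
  have hκcv : Valued.v (ρ (lam - jE u) / (ρ (lam - jE u) - (lam - jE u))) = exp (2 * (n : ℤ)) := by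
    rw [v_centre_eq hvρ (lam - jE u), hm, hjl, ← exp_sub]; congr 1; omega
  have hWσ : Valued.v (W - σ W) = exp (-(m : ℤ)) := by
    have h1 := map_centre_coord_sub σ jE hΘj hΘκ₀ hΘξ hWc
    have h3 : ρ (lam - jE u) / (ρ (lam - jE u) - (lam - jE u)) - Θ (ρ (lam - jE u) / (ρ (lam - jE u) - (lam - jE u))) =
        -(ρ (lam - jE u) / (ρ (lam - jE u) - (lam - jE u)) * ((lam - jE u) / jE u)) := by
      rw [← neg_sub, map_centre_sub_centre σ jE hΘj hρj hΘρ hΘlam huu hμρ]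
    have h2 : Valued.v (W - σ W) * Valued.v ξ₀ = exp (-(m : ℤ)) * Valued.v ξ₀ := by
      rw [← hjiso (W - σ W), ← Valuation.map_mul, h1.trans h3, Valuation.map_neg, Valuation.map_mul, hκcv, Valuation.map_div, hm,
        hjiso u, hu, div_one, hξv, mul_comm]
    exact mul_right_cancel₀ ((Valuation.ne_zero_iff _).2 hξ0) h2
  obtain ⟨W₁, hσW₁, hW1⟩ := exists_fixed_v_sub_mul_eq hσσ hϖσ W
  have hWWv : Valued.v (W - W₁) = exp (-(m : ℤ) - 1 + d) := by
    have h1 : Valued.v (W - W₁) * exp (-(d : ℤ)) = exp (-(m : ℤ) + (-1)) := by rw [← hPnE, ← hd, hW1, hWσ, hϖ, exp_add]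
    rw [(eq_mul_inv_iff_mul_eq₀ exp_ne_zero).2 h1, ← exp_neg, ← exp_add]; congr 1; ring
  have hWW : Valued.v (γ₁ * (W - W₁)) ≤ Valued.v ϖ ^ (2 * d - 1) := by
    rw [Valuation.map_mul, hγv, hθv, hWWv, ← exp_add, hPnE, exp_le_exp]; push_cast; omega
  have hWle : Valued.v W ≤ 1 := by
    have h1 : Valued.v (jE W) * Valued.v ξ₀ ≤ 1 * Valued.v ξ₀ := by
      rw [← Valuation.map_mul, hWc, one_mul]
      refine (Valuation.map_sub _ _ _).trans (max_le (by rw [hκcv, hξv]) (hκ₀1.trans ?_))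
      rw [hξv, ← exp_zero, exp_le_exp]; omega
    have h2 := (le_div_iff₀ hξpos).2 h1
    rwa [mul_div_assoc, div_self (ne_of_gt hξpos), mul_one, hjiso] at h2
  have hW₁1 : Valued.v W₁ ≤ 1 := by
    have e : W₁ = W - (W - W₁) := by ring
    rw [e]
    refine (Valuation.map_sub _ _ _).trans (max_le hWle ?_)
    rw [hWWv, ← exp_zero, exp_le_exp]; omega
  -- the digit sizes
  have hγn : Valued.v γ₁ * Valued.v ϖ ^ b = Valued.v ϖ ^ (m - b - d % 2) := by
    rw [hγv, hθv, hPnE, hPnE, ← exp_add, exp_inj]; push_cast; omega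
  have hγ1 : 1 ≤ Valued.v γ₁ := by rw [hγv, hθv, ← exp_zero, exp_le_exp]; push_cast; omega
  have hγr : Valued.v γ₁ * Valued.v ϖ ^ b ≤ Valued.v ϖ ^ (2 * d - 1) := by
    rw [hγv, hθv, hPnE, hPnE, ← exp_add, exp_le_exp]; push_cast; omega
  have hγe : Valued.v ϖ ^ (2 * d - 2) ≤ Valued.v γ₁ * Valued.v ϖ ^ (2 * d - 1) := by
    rw [hγv, hθv, hPnE, hPnE, ← exp_add, exp_le_exp]; push_cast; omega
  exact ⟨W, BE, γ₁, W₁, hWc, hBE, hσγ, hσW₁, by rw [hγv]; exact hθγ, hWW, hγn, hγ1, hγr, hγe, hW₁1⟩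

end Summit.HodgeConjecture.HodgeConjecture.Cruxes.H413.F0P3cDyRamUpperRayCellLetters

end
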